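import Literature.AlgebraicGeometry.Frobenioids.Thm42PrimaryStepsPropagation
import HarnessLib

/-!
# [FrdI] Theorem 4.2 (i): `Ψ` preserves AND reflects primary pre-steps — minimal-hypothesis forms

Mochizuki, *The geometry of Frobenioids I: the general theory*, Kyushu J. Math. **62** (2008)
293–400, §4, Theorem 4.2 (i), proof p. 78 l. 28 – p. 80 l. 17 (kurims) [cite: MochizukiFrdI2008, Thm. 4.2 (i) p.78].

PROOF-ONLY sequel of `Thm42PrimaryStepsPropagation.lean` (seat abc-iut-w4-d099). The transport theorem
`FrdI.T42.Setting.isPrimaryPreStep_map` there uses, of `FrdI.T42.Setting`, only: both Frobenioids of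
perfect and isotropic type with `Φ_i` perf-factorial; `Ψ` preserves steps and pre-steps; `Ψ⁻¹` preserves
pre-steps (Thm. 3.4 (ii)). Here:
* `PreFrobenioid.isPrimaryPreStep_map_of_preSteps` — the same conclusion under exactly these hypotheses
  (the hypothesis shape of `PreFrobenioid.existsUnique_primesEquiv_family`, Thm. 4.2 (ii), seat
  abc-iut-L1-t14, whose inputs «`Ψ`, `Ψ⁻¹` preserve primary pre-steps» are thereby theorems);
* `PreFrobenioid.isPrimaryPreStep_inverse_map_of_preSteps` — the quasi-inverse preserves primary pre-steps
  (the previous statement for `Ψ.symm`);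
* `PreFrobenioid.isPrimaryPreStep_map_iff_of_preSteps` — `Ψ` reflects primary pre-steps;
* `FrdI.T42.Setting.isPrimaryPreStep_inverse_map` / `…_map_iff` — the same over `FrdI.T42.Setting`.
No new definitions; nothing here bears on [IUTchIII].
-/

namespace Literature.AlgebraicGeometry.Frobenioids

open CategoryTheory Opposite

universe w v v' u u'

/-! ### 1. Minimal-hypothesis forms and the quasi-inverse -/

namespace PreFrobenioid

variable {D₁ : Type u} [Category.{v} D₁] {Φ₁ : D₁ᵒᵖ ⥤ CommMonCat.{w}} {C₁ : Type u'} [Category.{v'} C₁]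
  {D₂ : Type u} [Category.{v} D₂] {Φ₂ : D₂ᵒᵖ ⥤ CommMonCat.{w}} {C₂ : Type u'} [Category.{v'} C₂]
  {F₁ : C₁ ⥤ ElemFrobenioid Φ₁} {F₂ : C₂ ⥤ ElemFrobenioid Φ₂}

/-- An equivalence whose quasi-inverse preserves pre-steps REFLECTS pre-steps (`Ψ⁻¹Ψ(f) = η⁻¹ ∘ f ∘ η` and
Prop. 1.7 (v): the factors of a pre-step are pre-steps). [cite: MochizukiFrdI2008, Thm. 3.4 (ii) p.62] -/
theorem isPreStep_of_map_of_inverse (Ψ : C₁ ≌ C₂) (hF₁ : IsFrobenioid F₁)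
    (hpre' : ∀ ⦃X Y : C₂⦄ (φ : X ⟶ Y), IsPreStep F₂ φ → IsPreStep F₁ (Ψ.inverse.map φ))
    {X Y : C₁} (f : X ⟶ Y) (h : IsPreStep F₂ (Ψ.functor.map f)) : IsPreStep F₁ f := by
  have hD₁ := hF₁.isPreFrobenioid.isTotallyEpimorphic_base
  have h₂ : IsPreStep F₁ (Ψ.inverse.map (Ψ.functor.map f)) := hpre' _ h
  rw [Ψ.inv_fun_map] at h₂
  exact (isPreStep_factors F₁ hD₁ (isPreStep_factors F₁ hD₁ h₂).1).2

/-- **`Ψ` preserves primary pre-steps — minimal-hypothesis form** of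
`FrdI.T42.Setting.isPrimaryPreStep_map`: Frobenioids of perfect and isotropic type with `Φ_i`
perf-factorial, `Ψ` an equivalence preserving steps and pre-steps whose quasi-inverse preserves pre-steps
(Thm. 3.4 (ii)). This is the hypothesis «`Ψ` preserves primary pre-steps» of Thm. 4.2 (ii)
(`PreFrobenioid.existsUnique_primesEquiv_family`) discharged from Thm. 3.4 (ii) alone.
[cite: MochizukiFrdI2008, Thm. 4.2 (i) p.78] -/
theorem isPrimaryPreStep_map_of_preSteps (Ψ : C₁ ≌ C₂) (hF₁ : IsFrobenioid F₁) (hF₂ : IsFrobenioid F₂)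
    (hperf₁ : IsOfPerfectType F₁) (hperf₂ : IsOfPerfectType F₂)
    (histr₁ : IsOfIsotropicType F₁) (histr₂ : IsOfIsotropicType F₂)
    (hpf₁ : Objectwise (fun M _ => IsPerfFactorial M) Φ₁)
    (hpf₂ : Objectwise (fun M _ => IsPerfFactorial M) Φ₂)
    (hstep : ∀ ⦃X Y : C₁⦄ (φ : X ⟶ Y), IsStep F₁ φ → IsStep F₂ (Ψ.functor.map φ))
    (hpre : ∀ ⦃X Y : C₁⦄ (φ : X ⟶ Y), IsPreStep F₁ φ → IsPreStep F₂ (Ψ.functor.map φ))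
    (hpre' : ∀ ⦃X Y : C₂⦄ (φ : X ⟶ Y), IsPreStep F₂ φ → IsPreStep F₁ (Ψ.inverse.map φ))
    {A B : C₁} {φ : A ⟶ B} (hφ : IsPrimaryPreStep F₁ φ) : IsPrimaryPreStep F₂ (Ψ.functor.map φ) := by
  obtain ⟨hφpre, hφprim⟩ := hφ
  have hφpre₂ : IsPreStep F₂ (Ψ.functor.map φ) := hpre φ hφpre
  refine ⟨hφpre₂, ?_⟩
  have h₁ := (isPrimary_div_iff_of_isPreStep hF₁ hperf₁ histr₁ hpf₁ hφpre).mp hφprim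
  refine (isPrimary_div_iff_of_isPreStep hF₂ hperf₂ histr₂ hpf₂ hφpre₂).mpr ⟨?_, ?_⟩
  · have hst : IsStep F₁ φ := ⟨hφpre, fun hiso => hφprim.1 (by
      haveI := hiso
      exact isIsometry_of_isIso F₁ hF₁.isPreFrobenioid φ)⟩
    exact div_ne_one_of_isStep histr₂ (hstep φ hst)
  · rintro B₁' B₂' φ₁' φ₂' hφ₁' hφ₂' ⟨f₁', hf₁'⟩ ⟨f₂', hf₂'⟩
    let e₁ : Ψ.functor.obj (Ψ.functor.objPreimage B₁') ≅ B₁' := Ψ.functor.objObjPreimageIso B₁'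
    let e₂ : Ψ.functor.obj (Ψ.functor.objPreimage B₂') ≅ B₂' := Ψ.functor.objObjPreimageIso B₂'
    let φ₁ : A ⟶ Ψ.functor.objPreimage B₁' := Ψ.functor.preimage (φ₁' ≫ e₁.inv)
    let φ₂ : A ⟶ Ψ.functor.objPreimage B₂' := Ψ.functor.preimage (φ₂' ≫ e₂.inv)
    let f₁ : Ψ.functor.objPreimage B₁' ⟶ B := Ψ.functor.preimage (e₁.hom ≫ f₁')
    let f₂ : Ψ.functor.objPreimage B₂' ⟶ B := Ψ.functor.preimage (e₂.hom ≫ f₂')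
    have hφ₁m : Ψ.functor.map φ₁ = φ₁' ≫ e₁.inv := Ψ.functor.map_preimage _
    have hφ₂m : Ψ.functor.map φ₂ = φ₂' ≫ e₂.inv := Ψ.functor.map_preimage _
    have hf₁m : Ψ.functor.map f₁ = e₁.hom ≫ f₁' := Ψ.functor.map_preimage _
    have hf₂m : Ψ.functor.map f₂ = e₂.hom ≫ f₂' := Ψ.functor.map_preimage _
    have hφ₁ : IsPreStep F₁ φ₁ := isPreStep_of_map_of_inverse Ψ hF₁ hpre' φ₁ (by
      rw [hφ₁m]; exact IsPreStep.comp F₂ hφ₁' (isPreStep_of_isIso F₂ _))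
    have hφ₂ : IsPreStep F₁ φ₂ := isPreStep_of_map_of_inverse Ψ hF₁ hpre' φ₂ (by
      rw [hφ₂m]; exact IsPreStep.comp F₂ hφ₂' (isPreStep_of_isIso F₂ _))
    have hfac₁ : φ₁ ≫ f₁ = φ := Ψ.functor.map_injective (by
      rw [Functor.map_comp, hφ₁m, hf₁m, Category.assoc, e₁.inv_hom_id_assoc, hf₁'])
    have hfac₂ : φ₂ ≫ f₂ = φ := Ψ.functor.map_injective (by
      rw [Functor.map_comp, hφ₂m, hf₂m, Category.assoc, e₂.inv_hom_id_assoc, hf₂'])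
    rcases h₁.2 φ₁ φ₂ hφ₁ hφ₂ ⟨f₁, hfac₁⟩ ⟨f₂, hfac₂⟩ with ⟨g, hg⟩ | ⟨g, hg⟩
    · refine Or.inl ⟨e₁.inv ≫ Ψ.functor.map g ≫ e₂.hom, ?_⟩
      calc φ₁' ≫ e₁.inv ≫ Ψ.functor.map g ≫ e₂.hom
          = Ψ.functor.map (φ₁ ≫ g) ≫ e₂.hom := by
            rw [Functor.map_comp, hφ₁m]; simp only [Category.assoc]
        _ = φ₂' := by rw [hg, hφ₂m, Category.assoc, e₂.inv_hom_id, Category.comp_id]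
    · refine Or.inr ⟨e₂.inv ≫ Ψ.functor.map g ≫ e₁.hom, ?_⟩
      calc φ₂' ≫ e₂.inv ≫ Ψ.functor.map g ≫ e₁.hom
          = Ψ.functor.map (φ₂ ≫ g) ≫ e₁.hom := by
            rw [Functor.map_comp, hφ₂m]; simp only [Category.assoc]
        _ = φ₁' := by rw [hg, hφ₁m, Category.assoc, e₁.inv_hom_id, Category.comp_id]

/-- **The quasi-inverse `Ψ⁻¹` preserves primary pre-steps** (same hypotheses, applied to `Ψ.symm`): the
hypothesis «`Ψ⁻¹` preserves primary pre-steps» of Thm. 4.2 (ii)/(iii) discharged from Thm. 3.4 (ii)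
alone; equivalently, `Ψ` REFLECTS primary pre-steps. [cite: MochizukiFrdI2008, Thm. 4.2 (i) p.78] -/
theorem isPrimaryPreStep_inverse_map_of_preSteps (Ψ : C₁ ≌ C₂) (hF₁ : IsFrobenioid F₁)
    (hF₂ : IsFrobenioid F₂) (hperf₁ : IsOfPerfectType F₁) (hperf₂ : IsOfPerfectType F₂)
    (histr₁ : IsOfIsotropicType F₁) (histr₂ : IsOfIsotropicType F₂)
    (hpf₁ : Objectwise (fun M _ => IsPerfFactorial M) Φ₁)
    (hpf₂ : Objectwise (fun M _ => IsPerfFactorial M) Φ₂)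
    (hstep' : ∀ ⦃X Y : C₂⦄ (φ : X ⟶ Y), IsStep F₂ φ → IsStep F₁ (Ψ.inverse.map φ))
    (hpre : ∀ ⦃X Y : C₁⦄ (φ : X ⟶ Y), IsPreStep F₁ φ → IsPreStep F₂ (Ψ.functor.map φ))
    (hpre' : ∀ ⦃X Y : C₂⦄ (φ : X ⟶ Y), IsPreStep F₂ φ → IsPreStep F₁ (Ψ.inverse.map φ))
    {A B : C₂} {φ : A ⟶ B} (hφ : IsPrimaryPreStep F₂ φ) : IsPrimaryPreStep F₁ (Ψ.inverse.map φ) :=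
  isPrimaryPreStep_map_of_preSteps Ψ.symm hF₂ hF₁ hperf₂ hperf₁ histr₂ histr₁ hpf₂ hpf₁ hstep' hpre'
    hpre hφ

/-- **`Ψ` reflects primary pre-steps**: if `Ψ(φ)` is a primary pre-step then so is `φ` (same standing
hypotheses; `Ψ` preserves pre-steps, `Ψ⁻¹` preserves pre-steps). The order-theoretic criterion for `φ` is
checked by pushing factorizations forward along the fully faithful `Ψ`.
[cite: MochizukiFrdI2008, Thm. 4.2 (i) p.78] -/
theorem isPrimaryPreStep_of_map_of_preSteps (Ψ : C₁ ≌ C₂) (hF₁ : IsFrobenioid F₁)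
    (hF₂ : IsFrobenioid F₂) (hperf₁ : IsOfPerfectType F₁) (hperf₂ : IsOfPerfectType F₂)
    (histr₁ : IsOfIsotropicType F₁) (histr₂ : IsOfIsotropicType F₂)
    (hpf₁ : Objectwise (fun M _ => IsPerfFactorial M) Φ₁)
    (hpf₂ : Objectwise (fun M _ => IsPerfFactorial M) Φ₂)
    (hpre : ∀ ⦃X Y : C₁⦄ (φ : X ⟶ Y), IsPreStep F₁ φ → IsPreStep F₂ (Ψ.functor.map φ))
    (hpre' : ∀ ⦃X Y : C₂⦄ (φ : X ⟶ Y), IsPreStep F₂ φ → IsPreStep F₁ (Ψ.inverse.map φ))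
    {A B : C₁} {φ : A ⟶ B} (h : IsPrimaryPreStep F₂ (Ψ.functor.map φ)) : IsPrimaryPreStep F₁ φ := by
  obtain ⟨hpp, hprim⟩ := h
  have hφpre : IsPreStep F₁ φ := isPreStep_of_map_of_inverse Ψ hF₁ hpre' φ hpp
  refine ⟨hφpre, ?_⟩
  have h₂ := (isPrimary_div_iff_of_isPreStep hF₂ hperf₂ histr₂ hpf₂ hpp).mp hprim
  refine (isPrimary_div_iff_of_isPreStep hF₁ hperf₁ histr₁ hpf₁ hφpre).mpr ⟨?_, ?_⟩
  · -- `Div φ ≠ 0`: otherwise `φ` is an isomorphism (isotropic type), hence so is `Ψ(φ)`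
    intro h1
    haveI : IsIso φ := histr₁ A φ h1 hφpre
    exact h₂.1 (isIsometry_of_isIso F₂ hF₂.isPreFrobenioid (Ψ.functor.map φ))
  · rintro B₁ B₂ φ₁ φ₂ hφ₁ hφ₂ ⟨f₁, hf₁⟩ ⟨f₂, hf₂⟩
    have hm₁ : Ψ.functor.map φ₁ ≫ Ψ.functor.map f₁ = Ψ.functor.map φ := by
      rw [← Functor.map_comp, hf₁]
    have hm₂ : Ψ.functor.map φ₂ ≫ Ψ.functor.map f₂ = Ψ.functor.map φ := by
      rw [← Functor.map_comp, hf₂]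
    rcases h₂.2 _ _ (hpre φ₁ hφ₁) (hpre φ₂ hφ₂) ⟨_, hm₁⟩ ⟨_, hm₂⟩ with ⟨g', hg'⟩ | ⟨g', hg'⟩
    · refine Or.inl ⟨Ψ.functor.preimage g', Ψ.functor.map_injective ?_⟩
      rw [Functor.map_comp, Functor.map_preimage, hg']
    · refine Or.inr ⟨Ψ.functor.preimage g', Ψ.functor.map_injective ?_⟩
      rw [Functor.map_comp, Functor.map_preimage, hg']

/-- `Ψ(φ)` is a primary pre-step IFF `φ` is: `Ψ` preserves and reflects primary pre-steps.
[cite: MochizukiFrdI2008, Thm. 4.2 (i) p.78] -/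
theorem isPrimaryPreStep_map_iff_of_preSteps (Ψ : C₁ ≌ C₂) (hF₁ : IsFrobenioid F₁)
    (hF₂ : IsFrobenioid F₂) (hperf₁ : IsOfPerfectType F₁) (hperf₂ : IsOfPerfectType F₂)
    (histr₁ : IsOfIsotropicType F₁) (histr₂ : IsOfIsotropicType F₂)
    (hpf₁ : Objectwise (fun M _ => IsPerfFactorial M) Φ₁)
    (hpf₂ : Objectwise (fun M _ => IsPerfFactorial M) Φ₂)
    (hstep : ∀ ⦃X Y : C₁⦄ (φ : X ⟶ Y), IsStep F₁ φ → IsStep F₂ (Ψ.functor.map φ))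
    (hpre : ∀ ⦃X Y : C₁⦄ (φ : X ⟶ Y), IsPreStep F₁ φ → IsPreStep F₂ (Ψ.functor.map φ))
    (hpre' : ∀ ⦃X Y : C₂⦄ (φ : X ⟶ Y), IsPreStep F₂ φ → IsPreStep F₁ (Ψ.inverse.map φ))
    {A B : C₁} (φ : A ⟶ B) : IsPrimaryPreStep F₂ (Ψ.functor.map φ) ↔ IsPrimaryPreStep F₁ φ :=
  ⟨isPrimaryPreStep_of_map_of_preSteps Ψ hF₁ hF₂ hperf₁ hperf₂ histr₁ histr₂ hpf₁ hpf₂ hpre hpre',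
    isPrimaryPreStep_map_of_preSteps Ψ hF₁ hF₂ hperf₁ hperf₂ histr₁ histr₂ hpf₁ hpf₂ hstep hpre hpre'⟩

end PreFrobenioid

namespace FrdI.T42

variable {D₁ : Type u} [Category.{v} D₁] {Φ₁ : D₁ᵒᵖ ⥤ CommMonCat.{w}} {C₁ : Type u'} [Category.{v'} C₁]
  {D₂ : Type u} [Category.{v} D₂] {Φ₂ : D₂ᵒᵖ ⥤ CommMonCat.{w}} {C₂ : Type u'} [Category.{v'} C₂]
  {F₁ : C₁ ⥤ ElemFrobenioid Φ₁} {F₂ : C₂ ⥤ ElemFrobenioid Φ₂} {Ψ : C₁ ≌ C₂}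

/-- In the setting of Thm. 4.2 the quasi-inverse `Ψ⁻¹` preserves primary pre-steps (hypothesis of rows
T42-L08/L11 and of `PreFrobenioidData.thm42ii_of_perfectType`, now a theorem).
[cite: MochizukiFrdI2008, Thm. 4.2 (i) p.78] -/
theorem Setting.isPrimaryPreStep_inverse_map (S : Setting F₁ F₂ Ψ) {A B : C₂} {φ : A ⟶ B}
    (hφ : PreFrobenioid.IsPrimaryPreStep F₂ φ) : PreFrobenioid.IsPrimaryPreStep F₁ (Ψ.inverse.map φ) :=
  PreFrobenioid.isPrimaryPreStep_inverse_map_of_preSteps Ψ S.isFrobenioid₁ S.isFrobenioid₂ S.perfect₁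
    S.perfect₂ S.isotropic₁ S.isotropic₂ S.perfFactorial₁ S.perfFactorial₂ S.step_inv S.preStep_map
    S.preStep_inv hφ

/-- In the setting of Thm. 4.2, `Ψ(φ)` is a primary pre-step iff `φ` is.
[cite: MochizukiFrdI2008, Thm. 4.2 (i) p.78] -/
theorem Setting.isPrimaryPreStep_map_iff (S : Setting F₁ F₂ Ψ) {A B : C₁} (φ : A ⟶ B) :
    PreFrobenioid.IsPrimaryPreStep F₂ (Ψ.functor.map φ) ↔ PreFrobenioid.IsPrimaryPreStep F₁ φ :=
  PreFrobenioid.isPrimaryPreStep_map_iff_of_preSteps Ψ S.isFrobenioid₁ S.isFrobenioid₂ S.perfect₁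
    S.perfect₂ S.isotropic₁ S.isotropic₂ S.perfFactorial₁ S.perfFactorial₂ S.step_map S.preStep_map
    S.preStep_inv φ

end FrdI.T42

end Literature.AlgebraicGeometry.Frobenioids

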